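import Summits.ResolutionOfSingularities.ResolutionOfSingularities.Theorems.EquisingularLiftEquisingularLiftNatPlanarSmoothingLetter
import Summits.ResolutionOfSingularities.ResolutionOfSingularities.Theorems.EquisingularLiftEquisingularLiftNatPlanarSmoothingTraceFlat
import Summits.ResolutionOfSingularities.ResolutionOfSingularities.Theorems.EquisingularLiftEquisingularLiftNatEquinodalNoseRegularAssembly
import Summits.ResolutionOfSingularities.ResolutionOfSingularities.Theorems.EquisingularLiftEquisingularLiftNatEquinodalLetterModel
import Summits.ResolutionOfSingularities.ResolutionOfSingularities.Theorems.EquisingularLiftEquisingularLiftNatEquinodalNoseDatumOfSections3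
import Summits.ResolutionOfSingularities.ResolutionOfSingularities.Theorems.EquisingularLiftEquisingularLiftNatDeltaConeLift
import Summits.ResolutionOfSingularities.ResolutionOfSingularities.Theorems.EquisingularLiftEquisingularLiftNatResidueHypDefsE
import Literature.AlgebraicGeometry.Resolution.ProjectiveSpaceRegular
import Literature.AlgebraicGeometry.Motives.VarietiesProjectiveSpaceProofs
import HarnessLib

/-!
# [OURS · L1 W4.5(b) · EL♮(3) · NU7 §A2 «Σ1 SMOOTHING LEMMA», part 3] ★ `Equinodal.planar_trace_smoothing`: A REDUCED PLANAR TRACE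
# `Z = V₊(ℓ) ∩ V₊(g) ⊂ ℙ³_k` WITH FINITE NON-REGULAR LOCUS LIFTS TO A REGULAR, `O`-FLAT `V(𝓦) ⊂ ℙ³_O` WITH `𝓦 · 𝒪_{ℙ³_k} = 𝓘⟨Z⟩`

res-L1-w45b-stub-2 g19 (STUB WORKER 2 of chain w45b), the brick NAMED by the desk (res-L1-w45b-plan-1 g25, RULING R70 (iii); idea-2 NU7 §A2; crit-2
PRE-CLEAR of the SIGNATURE of record e3c9ce86dd96b53d, no reshape).  OURS; NOT a statement of any manuscript ([Hironaka2017] is a candidate under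
adjudication — nothing of it is asserted); AI-written, weaker than expert review.  No `sorry`; standard axioms; DEF-FREE; `--supports
stmt-ResolutionOfSingularities-20148 --as helper`, counted 0.  EL♮(3) is NOT proved here; resolution in positive characteristic is NOT proved anywhere
in this tree.  Customer-independent banked support: it changes no door text and deals no width.
WHAT.  Binders = the SIGNATURE of record VERBATIM (`k` algebraically closed, `O` a DVR, `θ : O ↠ k`, `φ = map θ`, `ℙ³_O` locally Noetherian and
regular, `q` proper; the door's non-zero linear `ℓ` and closed `Z`; «host regular along `Z̃`» verbatim; the non-regular locus of `Z̃ = redSub Z` finite;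
the first block of `EqCertAt₀`: `Z = V₊(ℓ) ∩ V₊(g)`, `g|_Π` SQUAREFREE).  CONCLUSION: `𝓦` on `ℙ³_O` with `V(𝓦)` REGULAR, `O`-FLAT, `𝓦 · 𝒪_{ℙ³_k} = 𝓘⟨Z⟩`.
PROOF (the Σ1 smoothing `𝓦_c = (L̃, σ̃ Ĝ + c·ϖ·σ̃ M̃)~`).  Lift the plane (✓ `HyperplaneLift.exists_hyperplane_lift`), lift `g|_Π` to `Ĝ`, choose a
linear form `λ'` missing the finitely many non-regular points of `Z̃` (part 2d `exists_linearForm_forall_notMem`) and lift `(λ'|_Π)^e` to `M̃`.  For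
EVERY `c`, `𝓦_c` has reduced trace `𝓘⟨Z⟩` and is `O`-flat (part 1 ✓ `smoothing_trace_and_flat`); under a REGULAR point of `Z̃` its local ring is
regular (✓ `isRegularLocalRing_quotient_stalkIdeal_of_model`); at each of the finitely many other points at most one residue class of `c` is bad
(part 2c ✓ `isRegularLocalRing_quotient_stalkIdeal_or`, fed by part 2d ✓ `germ_C_varpi_notMem_stalkIdeal_sup_sq`, the letter clauses
✓ `LetterModel.letter_clauses_projIdealSheaf` along `H = ℙ³_k`, and ✓ `isRegular_projectiveSpace`); `k` is infinite, so some `c₀` is good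
everywhere; closed points and specialisation as in ✓ W5g.  References (method / index only): H. Matsumura, *Commutative Ring Theory* (1986),
Thm. 14.2, 23.7; R. Hartshorne, *Algebraic Geometry* (1977), II Prop. 5.9, III Prop. 9.7.
-/

set_option linter.dupNamespace false -- mandated namespace `Summit.<Summit>.<Problem>` of this single-conjunct summit
set_option linter.overlappingInstances false -- signatures carry `[IsDomain O] [IsDiscreteValuationRing O]`

noncomputable section

open CategoryTheory CategoryTheory.Limits AlgebraicGeometry TopologicalSpace Topology IsLocalRing
open MvPolynomial HomogeneousLocalization
open Literature.AlgebraicGeometry.Resolution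
open AlgebraicGeometry.Scheme.IdealSheafData
open Summit.ResolutionOfSingularities.ResolutionOfSingularities.Cruxes.EquisingularLift.StrataSplit

namespace Summit.ResolutionOfSingularities.ResolutionOfSingularities.Cruxes.EquisingularLiftNat.Sections.Equinodal

open Summit.ResolutionOfSingularities.ResolutionOfSingularities.Cruxes.EquisingularLiftNat.Sections

set_option maxHeartbeats 1600000 in -- long binder list and the assembly
/-- ★ **Σ1 SMOOTHING LEMMA.**  A reduced planar trace `Z = V₊(ℓ) ∩ V₊(g) ⊂ ℙ³_k` (`g|_Π` squarefree) whose non-regular locus is finite lifts to a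
REGULAR `O`-FLAT closed subscheme `V(𝓦) ⊂ ℙ³_O` with reduced special fibre `𝓦 · 𝒪_{ℙ³_k} = 𝓘⟨Z⟩`.  See the module docstring.
[cite: Matsumura1987, Thm. 14.2] [cite: Hartshorne1977, III Prop. 9.7] [OURS · NU7 §A2 part 3; counted 0] -/
theorem planar_trace_smoothing (k : Type) [Field k] [IsAlgClosed k]
    (O : Type) [CommRing O] [IsDomain O] [IsDiscreteValuationRing O] (θ : O →+* k) (hθ : Function.Surjective θ) :
    letI := MvPolynomial.gradedAlgebra (σ := Fin (3 + 1)) (R := O); letI := MvPolynomial.gradedAlgebra (σ := Fin (3 + 1)) (R := k);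
    ∀ (φ : MvPolynomial.homogeneousSubmodule (Fin (3 + 1)) O →+*ᵍ MvPolynomial.homogeneousSubmodule (Fin (3 + 1)) k)
      (hφ' : HomogeneousIdeal.irrelevant (MvPolynomial.homogeneousSubmodule (Fin (3 + 1)) k) ≤ (HomogeneousIdeal.irrelevant (MvPolynomial.homogeneousSubmodule (Fin (3 + 1)) O)).map φ), (∀ s, φ s = MvPolynomial.map θ s) →
      IsLocallyNoetherian (AlgebraicGeometry.Proj (MvPolynomial.homogeneousSubmodule (Fin (3 + 1)) O)) → Literature.AlgebraicGeometry.Resolution.Scheme.IsRegular (AlgebraicGeometry.Proj (MvPolynomial.homogeneousSubmodule (Fin (3 + 1)) O)) → AlgebraicGeometry.IsProper (AlgebraicGeometry.Proj.toSpecZero (MvPolynomial.homogeneousSubmodule (Fin (3 + 1)) O) ≫ AlgebraicGeometry.Spec.map (CommRingCat.ofHom (algebraMap O (MvPolynomial.homogeneousSubmodule (Fin (3 + 1)) O 0)))) →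
    -- the door's `ℓ` and `Z`: a REDUCED PLANAR TRACE `Z = V₊(ℓ) ∩ V₊(g)`, `g|_Π` squarefree (the first block of `EqCertAt₀`, no node data)
    ∀ (ℓ : MvPolynomial (Fin (3 + 1)) k), ℓ.IsHomogeneous 1 → ℓ ≠ 0 →
      ∀ (Z : Set (Literature.AlgebraicGeometry.Motives.projectiveSpace 3 k).left) (hZ : IsClosed Z),
        -- host regular along `Z̃` (door binder, verbatim)
        (∀ (i : redSub (Literature.AlgebraicGeometry.Motives.projectiveSpace 3 k).left Z hZ ⟶ redSub (Literature.AlgebraicGeometry.Motives.projectiveSpace 3 k).left (closure {y : (Literature.AlgebraicGeometry.Motives.projectiveSpace 3 k).left | ℓ ∈ (y : ProjectiveSpectrum (MvPolynomial.homogeneousSubmodule (Fin (3 + 1)) k)).asHomogeneousIdeal}) isClosed_closure),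
              i ≫ redSubι (Literature.AlgebraicGeometry.Motives.projectiveSpace 3 k).left (closure {y : (Literature.AlgebraicGeometry.Motives.projectiveSpace 3 k).left | ℓ ∈ (y : ProjectiveSpectrum (MvPolynomial.homogeneousSubmodule (Fin (3 + 1)) k)).asHomogeneousIdeal}) isClosed_closure = redSubι (Literature.AlgebraicGeometry.Motives.projectiveSpace 3 k).left Z hZ →
              ∀ z : ↥(redSub (Literature.AlgebraicGeometry.Motives.projectiveSpace 3 k).left Z hZ), IsRegularLocalRing ((redSub (Literature.AlgebraicGeometry.Motives.projectiveSpace 3 k).left (closure {y : (Literature.AlgebraicGeometry.Motives.projectiveSpace 3 k).left | ℓ ∈ (y : ProjectiveSpectrum (MvPolynomial.homogeneousSubmodule (Fin (3 + 1)) k)).asHomogeneousIdeal}) isClosed_closure).presheaf.stalk (i.base z))) →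
        -- the non-regular locus of `Z̃` is finite ((N1); automatic for a reduced curve, taken as a binder)
        Set.Finite {z : ↥(redSub (Literature.AlgebraicGeometry.Motives.projectiveSpace 3 k).left Z hZ) |
          ¬ IsRegularLocalRing ((redSub (Literature.AlgebraicGeometry.Motives.projectiveSpace 3 k).left Z hZ).presheaf.stalk z)} →
        ∀ (e : ℕ) (g : MvPolynomial (Fin (3 + 1)) k) (B : Fin (3 + 1) → Fin 3 → k) (r : Fin 3 → Fin (3 + 1)),
          g.IsHomogeneous e → Squarefree (restrictToHyperplane B g) →
          Z = {y : (Literature.AlgebraicGeometry.Motives.projectiveSpace 3 k).left | ℓ ∈ (y : ProjectiveSpectrum (MvPolynomial.homogeneousSubmodule (Fin (3 + 1)) k)).asHomogeneousIdeal ∧ g ∈ (y : ProjectiveSpectrum (MvPolynomial.homogeneousSubmodule (Fin (3 + 1)) k)).asHomogeneousIdeal} →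
          restrictToHyperplane B ℓ = 0 → Function.Injective r → (Matrix.of fun j j' : Fin 3 => B (r j) j').det ≠ 0 →
    ∃ 𝓦 : (AlgebraicGeometry.Proj (MvPolynomial.homogeneousSubmodule (Fin (3 + 1)) O)).IdealSheafData,
      Literature.AlgebraicGeometry.Resolution.Scheme.IsRegular 𝓦.subscheme ∧
      AlgebraicGeometry.Flat (𝓦.subschemeι ≫ (AlgebraicGeometry.Proj.toSpecZero (MvPolynomial.homogeneousSubmodule (Fin (3 + 1)) O) ≫ AlgebraicGeometry.Spec.map (CommRingCat.ofHom (algebraMap O (MvPolynomial.homogeneousSubmodule (Fin (3 + 1)) O 0))))) ∧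
      𝓦.comap (AlgebraicGeometry.Proj.map φ hφ') = vanishingIdeal (⟨Z, hZ⟩ : Closeds (Literature.AlgebraicGeometry.Motives.projectiveSpace 3 k).left) := by
  classical
  letI := MvPolynomial.gradedAlgebra (σ := Fin (3 + 1)) (R := O)
  letI := MvPolynomial.gradedAlgebra (σ := Fin (3 + 1)) (R := k)
  intro φ hφ' hφ hPnoeth hPreg hqprop ℓ hℓ1 hℓ0 Z hZ hEreg hfin e g B r hg hsq hZeq hℓB hr hdet
  haveI := hPnoeth
  haveI := hqprop
  haveI : Infinite k := inferInstance
  obtain ⟨ϖ, hϖ⟩ := IsDiscreteValuationRing.exists_irreducible O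
  -- units and the uniformiser under `θ`
  have hkerθ : RingHom.ker θ = IsLocalRing.maximalIdeal O := ker_eq_maximalIdeal_of_surjective θ hθ
  have hunit : ∀ x : O, θ x ≠ 0 → IsUnit x := fun x hx => by
    by_contra h
    exact hx (show x ∈ RingHom.ker θ from hkerθ ▸ (h : x ∈ IsLocalRing.maximalIdeal O))
  have hθϖ : θ ϖ = 0 :=
    show ϖ ∈ RingHom.ker θ from hkerθ ▸ (IsLocalRing.mem_maximalIdeal ϖ).mpr hϖ.not_isUnit
  have hθunit : ∀ c₁ c₂ : O, θ c₁ ≠ θ c₂ → IsUnit (c₁ - c₂) := fun c₁ c₂ h => hunit _ (by rwa [map_sub, sub_ne_zero])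
  have hφX : ∀ i : Fin (3 + 1), φ (X i) = X i := fun i => by rw [hφ, map_X]
  -- the lifted hyperplane `L̃`, its reduction `λ = Σ θ(ct a) x_a`, `V₊(ℓ) = V₊(λ)`
  obtain ⟨a₀, Bt, ct, Nt, -, hBt, -, hcta₀, hψt, hsect, hkert, -, hkerk⟩ :=
    HyperplaneLift.exists_hyperplane_lift θ hθ hunit B r hr hdet
  have hdvd : (∑ a', C (θ (ct a')) * X a' : MvPolynomial (Fin (3 + 1)) k) ∣ ℓ := hkerk ℓ hℓB
  have hVlin := HostNormalForm.setOf_mem_eq_setOf_mem_linear (r := 2) (fun a' => θ (ct a')) a₀ (by simp only [hcta₀, map_one]) ℓ hdvd ℓ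
    hℓ1 hℓ0 rfl
  have hVpt : ∀ y : (Literature.AlgebraicGeometry.Motives.projectiveSpace 3 k).left,
      ℓ ∈ (y : ProjectiveSpectrum (homogeneousSubmodule (Fin (3 + 1)) k)).asHomogeneousIdeal ↔
      (∑ a', C (θ (ct a')) * X a' : MvPolynomial (Fin (3 + 1)) k) ∈
        (y : ProjectiveSpectrum (homogeneousSubmodule (Fin (3 + 1)) k)).asHomogeneousIdeal :=
    fun y => Set.ext_iff.mp hVlin y
  set Lt : MvPolynomial (Fin (3 + 1)) O := ∑ a', C (ct a') * X a' with hLtdef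
  have hLt1 : Lt ∈ homogeneousSubmodule (Fin (3 + 1)) O 1 := HyperplaneAlg.isHomogeneous_sum_C_mul_X ct id
  have hL : ∀ l, (![Lt] : Fin 1 → MvPolynomial (Fin (3 + 1)) O) l ∈ homogeneousSubmodule (Fin (3 + 1)) O ((![1] : Fin 1 → ℕ) l) := by
    intro l; fin_cases l; exact hLt1
  have hφLt : (φ Lt : MvPolynomial (Fin (3 + 1)) k) = ∑ a', C (θ (ct a')) * X a' := by
    rw [hφ]; exact HyperplaneLift.map_sum_C_mul_X θ ct
  have hL0 : (φ Lt : MvPolynomial (Fin (3 + 1)) k) ≠ 0 := fun h => by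
    rw [hφLt] at h; rw [h, zero_dvd_iff] at hdvd; exact hℓ0 hdvd
  -- the substitution `ψ` and the section `σ` downstairs; membership transfer on `V₊(λ)`
  let ψk : MvPolynomial (Fin (3 + 1)) k →ₐ[k] MvPolynomial (Fin 3) k :=
    MvPolynomial.aeval fun a' : Fin (3 + 1) => ∑ j : Fin 3, C (B a' j) * X j
  let σk : MvPolynomial (Fin 3) k → MvPolynomial (Fin (3 + 1)) k :=
    fun G => aeval (fun i : Fin 3 => ∑ j : Fin 3, C (θ (Nt i j)) * X (r j)) G
  have hψσk : ∀ G, ψk (σk G) = G := by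
    intro G
    obtain ⟨G', rfl⟩ := MvPolynomial.map_surjective θ hθ G
    change MvPolynomial.aeval _ (aeval _ (MvPolynomial.map θ G')) = _
    rw [← map_aeval_sect θ Nt r G', ← HyperplaneLift.map_aeval_linear θ Bt B hBt, hsect]
  have hσψ : ∀ y : Proj (homogeneousSubmodule (Fin (3 + 1)) k),
      (∑ a', C (θ (ct a')) * X a' : MvPolynomial (Fin (3 + 1)) k) ∈ y.asHomogeneousIdeal →
      ∀ f, f ∈ y.asHomogeneousIdeal ↔ σk (ψk f) ∈ y.asHomogeneousIdeal := by
    intro y hy f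
    obtain ⟨q', hq'⟩ := HyperplaneAlg.dvd_sub_section ψk.toRingHom σk _ hψσk hkerk f
    have hmem : f - σk (ψk f) ∈ y.asHomogeneousIdeal.toIdeal := by
      change f - σk (ψk.toRingHom f) ∈ _
      rw [hq']; exact Ideal.mul_mem_right _ _ hy
    refine ⟨fun hf => ?_, fun hs => ?_⟩
    · have h := Ideal.sub_mem _ (show f ∈ y.asHomogeneousIdeal.toIdeal from hf) hmem; rw [sub_sub_cancel] at h; exact h
    · have h := Ideal.add_mem _ hmem (show σk (ψk f) ∈ y.asHomogeneousIdeal.toIdeal from hs); rw [sub_add_cancel] at h; exact h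
  -- the reduced trace points: `yk zk ∈ Z ⊆ V₊(λ)`
  have hyZ : ∀ zk : ↥(redSub (Literature.AlgebraicGeometry.Motives.projectiveSpace 3 k).left Z hZ),
      (redSubι (Literature.AlgebraicGeometry.Motives.projectiveSpace 3 k).left Z hZ zk :
        (Literature.AlgebraicGeometry.Motives.projectiveSpace 3 k).left) ∈ Z := by
    intro zk
    have h : _ ∈ Set.range (redSubι (Literature.AlgebraicGeometry.Motives.projectiveSpace 3 k).left Z hZ) := ⟨zk, rfl⟩
    rw [Scheme.IdealSheafData.range_subschemeι, Scheme.IdealSheafData.coe_support_vanishingIdeal] at h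
    exact h
  have hZsub : Z ⊆ {y : (Literature.AlgebraicGeometry.Motives.projectiveSpace 3 k).left |
      ℓ ∈ (y : ProjectiveSpectrum (homogeneousSubmodule (Fin (3 + 1)) k)).asHomogeneousIdeal ∧
      g ∈ (y : ProjectiveSpectrum (homogeneousSubmodule (Fin (3 + 1)) k)).asHomogeneousIdeal} := hZeq.subset
  have hlamy : ∀ zk : ↥(redSub (Literature.AlgebraicGeometry.Motives.projectiveSpace 3 k).left Z hZ),
      (∑ a', C (θ (ct a')) * X a' : MvPolynomial (Fin (3 + 1)) k) ∈
        (redSubι (Literature.AlgebraicGeometry.Motives.projectiveSpace 3 k).left Z hZ zk :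
          ProjectiveSpectrum (homogeneousSubmodule (Fin (3 + 1)) k)).asHomogeneousIdeal := by
    intro zk
    have h := hZsub (hyZ zk)
    exact (hVpt _).mp h.1
  have hgy : ∀ zk : ↥(redSub (Literature.AlgebraicGeometry.Motives.projectiveSpace 3 k).left Z hZ),
      σk (ψk g) ∈ (redSubι (Literature.AlgebraicGeometry.Motives.projectiveSpace 3 k).left Z hZ zk :
          ProjectiveSpectrum (homogeneousSubmodule (Fin (3 + 1)) k)).asHomogeneousIdeal := by
    intro zk
    exact (hσψ _ (hlamy zk) g).mp (hZsub (hyZ zk)).2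
  -- standard charts
  have hchart := PlanarSmoothing.exists_mem_basicOpen_X (R := k) (n := 3)
  choose dch hdch using hchart
  have hxch : ∀ y : Proj (homogeneousSubmodule (Fin (3 + 1)) k),
      Proj.map φ hφ' y ∈ Proj.basicOpen (homogeneousSubmodule (Fin (3 + 1)) O) (X (dch y)) := by
    intro y
    rw [Proj.mem_basicOpen]
    change φ (X (dch y)) ∉ y.asHomogeneousIdeal
    rw [hφX]
    exact (Proj.mem_basicOpen _ _ _).mp (hdch y)
  -- the finite non-regular locus and a linear form `λ'` missing it
  set S : Set ↥(redSub (Literature.AlgebraicGeometry.Motives.projectiveSpace 3 k).left Z hZ) :=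
    {z | ¬ IsRegularLocalRing ((redSub (Literature.AlgebraicGeometry.Motives.projectiveSpace 3 k).left Z hZ).presheaf.stalk z)} with hSdef
  obtain ⟨lam, hlam1, hlam⟩ := PlanarSmoothing.exists_linearForm_forall_notMem (n := 3)
    ((fun zk => (redSubι (Literature.AlgebraicGeometry.Motives.projectiveSpace 3 k).left Z hZ zk :
      (Literature.AlgebraicGeometry.Motives.projectiveSpace 3 k).left)) '' S) (hfin.image _)
  have hlamS : ∀ zk ∈ S, lam ∉ (redSubι (Literature.AlgebraicGeometry.Motives.projectiveSpace 3 k).left Z hZ zk :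
      ProjectiveSpectrum (homogeneousSubmodule (Fin (3 + 1)) k)).asHomogeneousIdeal :=
    fun zk hzk => hlam _ ⟨zk, hzk, rfl⟩
  -- the lifts `Ĝ` of `g|_Π` and `M̃` of `(λ'|_Π)^e`; `A = σ̃ Ĝ`, `M = σ̃ M̃`
  obtain ⟨Gt0, hGt0e, hGt0g⟩ := exists_isHomogeneous_map_eq_of_surjective θ hθ (restrictToHyperplane B g)
    (isHomogeneous_restrictToHyperplane B g hg)
  have hMbare : (restrictToHyperplane B (lam ^ e)).IsHomogeneous e := by
    have h := hlam1.pow e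
    rw [one_mul] at h
    exact isHomogeneous_restrictToHyperplane B _ h
  obtain ⟨Mt, hMte, hMtm⟩ := exists_isHomogeneous_map_eq_of_surjective θ hθ _ hMbare
  set A : MvPolynomial (Fin (3 + 1)) O := aeval (fun i : Fin 3 => ∑ j : Fin 3, C (Nt i j) * X (r j)) Gt0 with hAdef
  set M : MvPolynomial (Fin (3 + 1)) O := aeval (fun i : Fin 3 => ∑ j : Fin 3, C (Nt i j) * X (r j)) Mt with hMdef
  have hA : A ∈ homogeneousSubmodule (Fin (3 + 1)) O e :=
    HyperplaneAlg.isHomogeneous_aeval_linear _ (fun i => HyperplaneAlg.isHomogeneous_sum_C_mul_X _ _) Gt0 hGt0e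
  have hM : M ∈ homogeneousSubmodule (Fin (3 + 1)) O e :=
    HyperplaneAlg.isHomogeneous_aeval_linear _ (fun i => HyperplaneAlg.isHomogeneous_sum_C_mul_X _ _) Mt hMte
  -- the smoothing family `𝓦_c = (L̃, A + c·ϖ·M)~`
  let W : O → (Proj (homogeneousSubmodule (Fin (3 + 1)) O)).IdealSheafData := fun c =>
    projIdealSheaf (homogeneousSubmodule (Fin (3 + 1)) O) ⟨Ideal.span (Set.range ![Lt, A + C (c * ϖ) * M]),
      isHomogeneous_span_of_forall_mem _ _ _ (PlanarSmoothing.pair_mem Lt A M hLt1 hA hM (c * ϖ))⟩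
  -- (1) reduced trace and flatness for every `c` (part 1)
  have hWtf : ∀ c : O, (W c).comap (Proj.map φ hφ') =
      vanishingIdeal (⟨Z, hZ⟩ : Closeds (Literature.AlgebraicGeometry.Motives.projectiveSpace 3 k).left) ∧
      Flat ((W c).subschemeι ≫ (Proj.toSpecZero (homogeneousSubmodule (Fin (3 + 1)) O) ≫
        Spec.map (CommRingCat.ofHom (algebraMap O (homogeneousSubmodule (Fin (3 + 1)) O 0))))) := by
    intro c
    have hGte : (Gt0 + C (c * ϖ) * Mt).IsHomogeneous e := hGt0e.add (hMte.C_mul (c * ϖ))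
    have hGtg : MvPolynomial.map θ (Gt0 + C (c * ϖ) * Mt) = restrictToHyperplane B g := by
      rw [map_add, map_mul, map_C, map_mul θ, hθϖ, mul_zero, C_0, zero_mul, add_zero, hGt0g]
    have hσc : aeval (fun i : Fin 3 => ∑ j : Fin 3, C (Nt i j) * X (r j)) (Gt0 + C (c * ϖ) * Mt) = A + C (c * ϖ) * M := by
      rw [map_add, map_mul, aeval_C, MvPolynomial.algebraMap_eq]
    have hF : ∀ l, (![Lt, (aeval (fun i : Fin 3 => ∑ j : Fin 3, C (Nt i j) * X (r j)) (Gt0 + C (c * ϖ) * Mt) :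
        MvPolynomial (Fin (3 + 1)) O)] : Fin 2 → MvPolynomial (Fin (3 + 1)) O) l ∈
        homogeneousSubmodule (Fin (3 + 1)) O ((![1, e] : Fin 2 → ℕ) l) := by
      intro l; fin_cases l
      · exact hLt1
      · exact HyperplaneAlg.isHomogeneous_aeval_linear _ (fun i => HyperplaneAlg.isHomogeneous_sum_C_mul_X _ _) _ hGte
    have h := smoothing_trace_and_flat k O θ hθ φ hφ' hφ ℓ Z hZ e g B r hg hsq hZeq Bt ct Nt hBt hψt hsect hkert hVlin
      (Gt0 + C (c * ϖ) * Mt) hGte hGtg hF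
    have hSW : projIdealSheaf (homogeneousSubmodule (Fin (3 + 1)) O) ⟨Ideal.span (Set.range ![Lt,
        (aeval (fun i : Fin 3 => ∑ j : Fin 3, C (Nt i j) * X (r j)) (Gt0 + C (c * ϖ) * Mt) : MvPolynomial (Fin (3 + 1)) O)]),
          isHomogeneous_span_of_forall_mem _ _ _ hF⟩ = W c :=
      congrArg (projIdealSheaf (homogeneousSubmodule (Fin (3 + 1)) O)) (HomogeneousIdeal.ext (by
        change Ideal.span _ = Ideal.span _
        rw [hσc]))
    rw [hSW] at h
    exact h
  -- (2) points of the special fibre under `Z̃`: memberships at `x = g (yk zk)`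
  have hxϖ : ∀ y : Proj (homogeneousSubmodule (Fin (3 + 1)) k),
      (C ϖ : MvPolynomial (Fin (3 + 1)) O) ∈ (Proj.map φ hφ' y).asHomogeneousIdeal := by
    intro y
    change φ (C ϖ) ∈ y.asHomogeneousIdeal
    rw [hφ, map_C, hθϖ, C_0]; exact zero_mem _
  have hLtx : ∀ zk : ↥(redSub (Literature.AlgebraicGeometry.Motives.projectiveSpace 3 k).left Z hZ),
      Lt ∈ (Proj.map φ hφ' (redSubι (Literature.AlgebraicGeometry.Motives.projectiveSpace 3 k).left Z hZ zk)).asHomogeneousIdeal := by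
    intro zk
    change φ Lt ∈ (redSubι (Literature.AlgebraicGeometry.Motives.projectiveSpace 3 k).left Z hZ zk :
      ProjectiveSpectrum (homogeneousSubmodule (Fin (3 + 1)) k)).asHomogeneousIdeal
    rw [hφLt]; exact hlamy zk
  have hAx : ∀ zk : ↥(redSub (Literature.AlgebraicGeometry.Motives.projectiveSpace 3 k).left Z hZ),
      A ∈ (Proj.map φ hφ' (redSubι (Literature.AlgebraicGeometry.Motives.projectiveSpace 3 k).left Z hZ zk)).asHomogeneousIdeal := by
    intro zk
    change φ A ∈ (redSubι (Literature.AlgebraicGeometry.Motives.projectiveSpace 3 k).left Z hZ zk :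
      ProjectiveSpectrum (homogeneousSubmodule (Fin (3 + 1)) k)).asHomogeneousIdeal
    rw [hφ, hAdef, map_aeval_sect θ Nt r Gt0, hGt0g]
    exact hgy zk
  have hMx : ∀ zk ∈ S, M ∉ (Proj.map φ hφ' (redSubι (Literature.AlgebraicGeometry.Motives.projectiveSpace 3 k).left Z hZ zk)).asHomogeneousIdeal := by
    intro zk hzk h
    change φ M ∈ (redSubι (Literature.AlgebraicGeometry.Motives.projectiveSpace 3 k).left Z hZ zk :
      ProjectiveSpectrum (homogeneousSubmodule (Fin (3 + 1)) k)).asHomogeneousIdeal at h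
    rw [hφ, hMdef, map_aeval_sect θ Nt r Mt, hMtm] at h
    have h2 := (hσψ _ (hlamy zk) (lam ^ e)).mpr h
    exact hlamS zk hzk ((redSubι (Literature.AlgebraicGeometry.Motives.projectiveSpace 3 k).left Z hZ zk :
      ProjectiveSpectrum (homogeneousSubmodule (Fin (3 + 1)) k)).isPrime.mem_of_pow_mem e h2)
  -- (3) the letter `𝓛 = (L̃)~`: regular `V(𝓛)`, trace `𝓘⟨Ẽ⟩` (letter clauses along `H = ℙ³_k`)
  haveI : IsIntegral (Proj (homogeneousSubmodule (Fin (3 + 1)) k)) := isIntegral_proj_homogeneousSubmodule 3 k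
  have hH : ¬ Set.range (𝟙 (Proj (homogeneousSubmodule (Fin (3 + 1)) k)) : _ ⟶ _) ⊆
      {y : Proj (homogeneousSubmodule (Fin (3 + 1)) k) | (φ Lt : MvPolynomial (Fin (3 + 1)) k) ∈ y.asHomogeneousIdeal} := by
    intro h
    have hη := h ⟨Literature.AlgebraicGeometry.Motives.ProjectiveSpace.genericPoint 3 k, rfl⟩
    change (φ Lt : MvPolynomial (Fin (3 + 1)) k) ∈ (⊥ : HomogeneousIdeal (homogeneousSubmodule (Fin (3 + 1)) k)) at hη
    rw [← HomogeneousIdeal.mem_iff, HomogeneousIdeal.toIdeal_bot, Ideal.mem_bot] at hη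
    exact hL0 hη
  obtain ⟨hl1, -, hl3, -, -⟩ := LetterModel.letter_clauses_projIdealSheaf (r := 2) θ hθ φ hφ hφ' ct a₀ 1 (by rw [hcta₀, one_mul])
    (φ Lt) (hφ Lt).symm (Proj (homogeneousSubmodule (Fin (3 + 1)) k)) (𝟙 _) hH hL
  -- `closure V₊(φ L̃) = closure V₊(ℓ)` as closed sets
  have hl1' : (projIdealSheaf (homogeneousSubmodule (Fin (3 + 1)) O) ⟨Ideal.span (Set.range ![Lt]),
      isHomogeneous_span_of_forall_mem _ _ _ (PlanarSmoothing.single_mem Lt hLt1)⟩).comap (Proj.map φ hφ') =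
      vanishingIdeal (⟨closure {y : (Literature.AlgebraicGeometry.Motives.projectiveSpace 3 k).left |
        (φ Lt : MvPolynomial (Fin (3 + 1)) k) ∈ (y : ProjectiveSpectrum (homogeneousSubmodule (Fin (3 + 1)) k)).asHomogeneousIdeal},
          isClosed_closure⟩ : Closeds (Literature.AlgebraicGeometry.Motives.projectiveSpace 3 k).left) := hl1
  have hcl : (⟨closure {y : (Literature.AlgebraicGeometry.Motives.projectiveSpace 3 k).left |
        (φ Lt : MvPolynomial (Fin (3 + 1)) k) ∈ (y : ProjectiveSpectrum (homogeneousSubmodule (Fin (3 + 1)) k)).asHomogeneousIdeal},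
          isClosed_closure⟩ : Closeds (Literature.AlgebraicGeometry.Motives.projectiveSpace 3 k).left) =
      ⟨closure {y : (Literature.AlgebraicGeometry.Motives.projectiveSpace 3 k).left |
        ℓ ∈ (y : ProjectiveSpectrum (homogeneousSubmodule (Fin (3 + 1)) k)).asHomogeneousIdeal}, isClosed_closure⟩ := by
    apply Closeds.ext
    change closure _ = closure _
    congr 1
    ext y
    simp only [Set.mem_setOf_eq]
    rw [hφLt]
    exact (hVpt y).symm
  have hcomapE : (projIdealSheaf (homogeneousSubmodule (Fin (3 + 1)) O) ⟨Ideal.span (Set.range ![Lt]),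
      isHomogeneous_span_of_forall_mem _ _ _ (PlanarSmoothing.single_mem Lt hLt1)⟩).comap (Proj.map φ hφ') =
      vanishingIdeal (⟨closure {y : (Literature.AlgebraicGeometry.Motives.projectiveSpace 3 k).left |
        ℓ ∈ (y : ProjectiveSpectrum (homogeneousSubmodule (Fin (3 + 1)) k)).asHomogeneousIdeal}, isClosed_closure⟩ :
          Closeds (Literature.AlgebraicGeometry.Motives.projectiveSpace 3 k).left) := by
    rw [← hcl]; exact hl1'
  have hLreg : Scheme.IsRegular (projIdealSheaf (homogeneousSubmodule (Fin (3 + 1)) O) ⟨Ideal.span (Set.range ![Lt]),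
      isHomogeneous_span_of_forall_mem _ _ _ (PlanarSmoothing.single_mem Lt hLt1)⟩).subscheme := hl3
  -- the inclusion `Z̃ ⟶ Ẽ`
  have hZE : Z ⊆ closure {y : (Literature.AlgebraicGeometry.Motives.projectiveSpace 3 k).left |
      ℓ ∈ (y : ProjectiveSpectrum (homogeneousSubmodule (Fin (3 + 1)) k)).asHomogeneousIdeal} := by
    exact fun y hy => subset_closure (hZsub hy).1
  have hle : vanishingIdeal (⟨closure {y : (Literature.AlgebraicGeometry.Motives.projectiveSpace 3 k).left |
      ℓ ∈ (y : ProjectiveSpectrum (homogeneousSubmodule (Fin (3 + 1)) k)).asHomogeneousIdeal}, isClosed_closure⟩ :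
        Closeds (Literature.AlgebraicGeometry.Motives.projectiveSpace 3 k).left) ≤
      vanishingIdeal (⟨Z, hZ⟩ : Closeds (Literature.AlgebraicGeometry.Motives.projectiveSpace 3 k).left) :=
    vanishingIdeal_antimono (show (⟨Z, hZ⟩ : Closeds (Literature.AlgebraicGeometry.Motives.projectiveSpace 3 k).left) ≤ ⟨closure _, isClosed_closure⟩ from hZE)
  let ιZE := Scheme.IdealSheafData.inclusion hle
  have hιfac : ιZE ≫ redSubι (Literature.AlgebraicGeometry.Motives.projectiveSpace 3 k).left (closure {y : (Literature.AlgebraicGeometry.Motives.projectiveSpace 3 k).left |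
      ℓ ∈ (y : ProjectiveSpectrum (homogeneousSubmodule (Fin (3 + 1)) k)).asHomogeneousIdeal}) isClosed_closure =
      redSubι (Literature.AlgebraicGeometry.Motives.projectiveSpace 3 k).left Z hZ := Scheme.IdealSheafData.inclusion_subschemeι hle
  have hιpt : ∀ zk : ↥(redSub (Literature.AlgebraicGeometry.Motives.projectiveSpace 3 k).left Z hZ),
      (redSubι (Literature.AlgebraicGeometry.Motives.projectiveSpace 3 k).left (closure {y : (Literature.AlgebraicGeometry.Motives.projectiveSpace 3 k).left |
        ℓ ∈ (y : ProjectiveSpectrum (homogeneousSubmodule (Fin (3 + 1)) k)).asHomogeneousIdeal}) isClosed_closure) (ιZE zk) =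
      redSubι (Literature.AlgebraicGeometry.Motives.projectiveSpace 3 k).left Z hZ zk := by
    intro zk
    rw [← Scheme.Hom.comp_apply, hιfac]
  -- (4) `Θ_x ϖ ∉ 𝓛_x + 𝔪_x²` at every point under `Z̃` (part 2d)
  have hϖL : ∀ zk : ↥(redSub (Literature.AlgebraicGeometry.Motives.projectiveSpace 3 k).left Z hZ),
      ((Proj (homogeneousSubmodule (Fin (3 + 1)) O)).presheaf.germ (Proj.basicOpen (homogeneousSubmodule (Fin (3 + 1)) O)
        (X (dch (redSubι (Literature.AlgebraicGeometry.Motives.projectiveSpace 3 k).left Z hZ zk))))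
          (Proj.map φ hφ' (redSubι (Literature.AlgebraicGeometry.Motives.projectiveSpace 3 k).left Z hZ zk))
          (hxch (redSubι (Literature.AlgebraicGeometry.Motives.projectiveSpace 3 k).left Z hZ zk))).hom
        ((Proj.awayToSection (homogeneousSubmodule (Fin (3 + 1)) O)
          (X (dch (redSubι (Literature.AlgebraicGeometry.Motives.projectiveSpace 3 k).left Z hZ zk)))).hom
          (mk₁ (homogeneousSubmodule (Fin (3 + 1)) O) (CILift.X_mem_one' (dch (redSubι (Literature.AlgebraicGeometry.Motives.projectiveSpace 3 k).left Z hZ zk)))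
            0 (C ϖ) (isHomogeneous_C _ ϖ))) ∉
      stalkIdeal (projIdealSheaf (homogeneousSubmodule (Fin (3 + 1)) O) ⟨Ideal.span (Set.range ![Lt]),
          isHomogeneous_span_of_forall_mem _ _ _ (PlanarSmoothing.single_mem Lt hLt1)⟩)
          (Proj.map φ hφ' (redSubι (Literature.AlgebraicGeometry.Motives.projectiveSpace 3 k).left Z hZ zk)) ⊔
        maximalIdeal ((Proj (homogeneousSubmodule (Fin (3 + 1)) O)).presheaf.stalk
          (Proj.map φ hφ' (redSubι (Literature.AlgebraicGeometry.Motives.projectiveSpace 3 k).left Z hZ zk))) ^ 2 := by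
    intro zk
    exact PlanarSmoothing.germ_C_varpi_notMem_stalkIdeal_sup_sq hϖ θ hθϖ (dch _) φ hφ' hφ _ (hdch _) (hxch _)
      (isRegular_projectiveSpace 3 k _) Lt hLt1 (hLtx zk) hL0 _ hcomapE (ιZE zk) (hιpt zk) (hEreg ιZE hιfac zk)
  -- (5) at the finitely many non-regular points: the bad residues form a finite set; choose `c₀` outside
  set T : Set k := ⋃ zk ∈ S, {a : k | ∃ c : O, θ c = a ∧
      ¬ IsRegularLocalRing (((Proj (homogeneousSubmodule (Fin (3 + 1)) O)).presheaf.stalk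
        (Proj.map φ hφ' (redSubι (Literature.AlgebraicGeometry.Motives.projectiveSpace 3 k).left Z hZ zk)) : Type) ⧸
        stalkIdeal (W c) (Proj.map φ hφ' (redSubι (Literature.AlgebraicGeometry.Motives.projectiveSpace 3 k).left Z hZ zk)))} with hTdef
  have hTfin : T.Finite := by
    refine hfin.biUnion fun zk hzk => Set.Subsingleton.finite ?_
    intro a ha b hb
    obtain ⟨ca, rfl, hca⟩ := ha
    obtain ⟨cb, rfl, hcb⟩ := hb
    by_contra hab
    rcases PlanarSmoothing.isRegularLocalRing_quotient_stalkIdeal_or (e := e) (dch _) _ (hxch _) (hxϖ _) Lt A M hLt1 hA hM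
        (hLtx zk) (hAx zk) (hMx zk hzk) (fun x' _ => hLreg x') (hϖL zk) ca cb (hθunit ca cb hab) with h | h
    · exact hca h
    · exact hcb h
  obtain ⟨a₁, ha₁⟩ := hTfin.infinite_compl.nonempty
  obtain ⟨c₀, hc₀⟩ := hθ a₁
  have hgood : ∀ zk ∈ S, IsRegularLocalRing (((Proj (homogeneousSubmodule (Fin (3 + 1)) O)).presheaf.stalk
      (Proj.map φ hφ' (redSubι (Literature.AlgebraicGeometry.Motives.projectiveSpace 3 k).left Z hZ zk)) : Type) ⧸
      stalkIdeal (W c₀) (Proj.map φ hφ' (redSubι (Literature.AlgebraicGeometry.Motives.projectiveSpace 3 k).left Z hZ zk))) := by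
    intro zk hzk
    by_contra h
    exact ha₁ (Set.mem_biUnion hzk ⟨c₀, hc₀, h⟩)
  -- (6) the assembly: `V(𝓦_{c₀})` is regular (closed points and specialisation, as W5g)
  refine ⟨W c₀, ?_, (hWtf c₀).2, (hWtf c₀).1⟩
  have hP := ProjectiveAmbientFibre.isPullback_projMap θ φ hφ hθ hφ'
  have hrange : Set.range (Proj.map φ hφ') = (Proj.toSpecZero (homogeneousSubmodule (Fin (3 + 1)) O) ≫
      Spec.map (CommRingCat.ofHom (algebraMap O (homogeneousSubmodule (Fin (3 + 1)) O 0)))) ⁻¹' {IsLocalRing.closedPoint O} := by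
    rw [range_eq_preimage_of_isPullback hP, range_specMap_of_surjective_of_field θ hθ]
  haveI : IsClosedImmersion (Spec.map (CommRingCat.ofHom θ)) := IsClosedImmersion.spec_of_surjective _ hθ
  haveI : IsClosedImmersion (Proj.map φ hφ') := MorphismProperty.IsStableUnderBaseChange.of_isPullback hP.flip inferInstance
  haveI := (hWtf c₀).2
  haveI : CompactSpace ↥(Spec (.of O)) := (inferInstance : CompactSpace (PrimeSpectrum O))
  haveI : CompactSpace ↥(W c₀).subscheme := QuasiCompact.compactSpace_of_compactSpace ((W c₀).subschemeι ≫
    (Proj.toSpecZero (homogeneousSubmodule (Fin (3 + 1)) O) ≫ Spec.map (CommRingCat.ofHom (algebraMap O (homogeneousSubmodule (Fin (3 + 1)) O 0)))))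
  intro x
  obtain ⟨z, hxz, hzcl⟩ := exists_specializes_isClosed x
  have hιzcl : IsClosed ({(W c₀).subschemeι z} : Set (Proj (homogeneousSubmodule (Fin (3 + 1)) O))) := by
    rw [← Set.image_singleton]; exact (W c₀).subschemeι.isClosedMap _ hzcl
  have hqz : (Proj.toSpecZero (homogeneousSubmodule (Fin (3 + 1)) O) ≫
      Spec.map (CommRingCat.ofHom (algebraMap O (homogeneousSubmodule (Fin (3 + 1)) O 0)))) ((W c₀).subschemeι z) =
      IsLocalRing.closedPoint O := by
    have h := apply_eq_closedPoint_of_isClosed ((W c₀).subschemeι ≫ (Proj.toSpecZero (homogeneousSubmodule (Fin (3 + 1)) O) ≫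
      Spec.map (CommRingCat.ofHom (algebraMap O (homogeneousSubmodule (Fin (3 + 1)) O 0))))) hzcl
    rwa [Scheme.Hom.comp_apply] at h
  obtain ⟨y, hy⟩ : (W c₀).subschemeι z ∈ Set.range (Proj.map φ hφ') := by rw [hrange]; exact hqz
  have hyZ' : y ∈ Z := by
    have hmem : y ∈ (((W c₀).comap (Proj.map φ hφ')).support : Set (Proj (homogeneousSubmodule (Fin (3 + 1)) k))) := by
      rw [Scheme.IdealSheafData.support_comap]
      change Proj.map φ hφ' y ∈ ((W c₀).support : Set (Proj (homogeneousSubmodule (Fin (3 + 1)) O)))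
      rw [hy, ← Scheme.IdealSheafData.range_subschemeι]
      exact ⟨z, rfl⟩
    rw [(hWtf c₀).1] at hmem
    change y ∈ ((Scheme.IdealSheafData.vanishingIdeal (⟨Z, hZ⟩ : Closeds (Literature.AlgebraicGeometry.Motives.projectiveSpace 3 k).left)).support :
      Set (Literature.AlgebraicGeometry.Motives.projectiveSpace 3 k).left) at hmem
    rw [Scheme.IdealSheafData.coe_support_vanishingIdeal] at hmem
    exact hmem
  obtain ⟨zk, hzk⟩ : y ∈ Set.range (redSubι (Literature.AlgebraicGeometry.Motives.projectiveSpace 3 k).left Z hZ) := by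
    rw [Scheme.IdealSheafData.range_subschemeι, Scheme.IdealSheafData.coe_support_vanishingIdeal]; exact hyZ'
  have hquot : IsRegularLocalRing (((Proj (homogeneousSubmodule (Fin (3 + 1)) O)).presheaf.stalk (Proj.map φ hφ' y) : Type) ⧸
      stalkIdeal (W c₀) (Proj.map φ hφ' y)) := by
    by_cases hreg : IsRegularLocalRing ((redSub (Literature.AlgebraicGeometry.Motives.projectiveSpace 3 k).left Z hZ).presheaf.stalk zk)
    · subst hzk
      exact isRegularLocalRing_quotient_stalkIdeal_of_model O k θ hθ _ _ _ hP _ (hWtf c₀).1 zk hreg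
    · rw [← hzk]
      exact hgood zk hreg
  have hz : IsRegularLocalRing ((W c₀).subscheme.presheaf.stalk z) :=
    (isRegularLocalRing_subscheme_stalk_iff_of_eq (W c₀) z _ rfl).mpr (by rw [← hy]; exact hquot)
  exact isRegularLocalRing_stalk_of_specializes hxz hz

end Summit.ResolutionOfSingularities.ResolutionOfSingularities.Cruxes.EquisingularLiftNat.Sections.Equinodal

end
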